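import Summits.Ventures.CertifiedArithmetic.LowPrec.DoubleRoundingProductMatrix
import Summits.Ventures.CertifiedArithmetic.LowPrec.DoubleRoundingDivisionEqualPrecision
import Summits.Ventures.CertifiedArithmetic.LowPrec.DoubleRoundingProductSameQuantumLow
import Summits.Ventures.CertifiedArithmetic.LowPrec.DoubleRoundingSqrtEqualPrecision

/-!
# Double rounding of products at equal precision: innocuous iff the quanta agree (N-mul-E, D-mul-E)

HONEST FRAMING (venture CertifiedArithmetic / cell `pub-lowprec`): certified error envelopes and
provably optimal rounding/accumulation schemes for low-precision formats under stated cost models;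
every table by two implementations; no hardware or vendor claims.

`DRMul φ ψ` (`DoubleRoundingProductUnderflow.lean`): ONE product of `φ`-data rounded in the
register format `ψ` and converted to `φ` is the correctly rounded product of `φ` (saturating
RNE, subnormals kept).  This file settles the registers of EQUAL PRECISION (`m_ψ = m_φ = m`,
`P = m + 1`): `ψ` has the digits of `φ` and possibly more binades below (a finer quantum,
`d = L_φ - L_ψ ≥ 0`, `L = qexp`).  THEOREM N-mul-U (`not_drMul_of_underflow`) already shows that
a quantum `1 ≤ d ≤ P` binades finer slips, for any `P_ψ`; at equal precision the same two data
slip at EVERY `d ≥ 1`, and at `d = 0` nothing slips: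

* §1 THEOREM N-mul-E (`not_drMul_of_equal_precision`, every pair of records): `m_ψ = m_φ = m ≥ 1`,
  `d ≥ 1`, the data `a = (2^(m+1) - 1)·2^α`, `b = (2^m + 1)·2^β` quanta of `φ` in range with
  `α + β + m + 3 = bias φ`, and `2^(d-1) ≤ M_ψ` `⟹ ¬ DRMul φ ψ`.  The product is
  `a·b = q/2 + ε`, `ε = (2^m - 1)·q/2^(2m+2)` (`q = quantum φ`).  For `d ≤ m + 1` this is
  N-mul-U.  For `d ≥ m + 2` the midpoint `q/2 = 2^m · 2^(d-1-m)` quanta of `ψ` is a NORMAL value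
  of `ψ` with the full significand `2^m`, above which the spacing of `ψ` is `2^(d-1-m)` quanta of
  `ψ` `= q/2^(m+1)`, and `2ε < q/2^(m+1)`: so `fl_ψ (a·b) = q/2` (`toRat_roundNE_full_add_small`),
  `fl_φ (q/2) = 0` (tie to even) while `fl_φ (a·b) = q`.  No inclusion `F_φ ⊆ F_ψ` is assumed.
* §2 THE CONVERSE AT `d = 0` (`drMul_of_equal_precision_sameQ`, every pair of records):
  `L_ψ = L_φ`, `m_ψ = m_φ = m ≥ 1`, `M_φ ≤ M_ψ` `⟹ DRMul φ ψ` — indeed every dyadic `K·q/2^u`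
  double-rounds correctly (`sameQ_eqPrec_roundNE_roundNE`): below `2^(m+1) q` both formats hold
  every multiple of `q` in range (`sameQ_roundNE_roundNE_low`), from `2^m q` on they agree by the
  band corollary (`toRat_roundNE_roundNE_of_manBits_eq_of_le`).  (Clause (G) of `drMulTest` needs
  the same `bias` and `emaxCode`; here only the quantum and `M_φ ≤ M_ψ`: no range hypothesis.)
* §3 DECISION D-mul-E (`drMul_equal_precision_iff`): for `F_φ ⊆ F_ψ` (`embedsTest`),
  `m_ψ = m_φ = m ≥ 1`, a DEEP source (`m + 3 ≤ bias φ`, i.e. `L_φ ≤ -2P`) with `2^(m+1) - 1` and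
  `(2^m + 1)·2^(bias-m-3)` quanta in range:  `DRMul φ ψ ↔ L_ψ = L_φ`.  The hypothesis of N-mul-E
  at the canonical exponents is the boolean `drMulEqPrecTest` (`not_drMul_of_eqPrecTest`).
* §4 THE NAMED RECORDS.  On the `13 × 13` matrix `drMulEqPrecTest` holds on exactly the `4` cells
  of `drMulUnderflowTest` (all `d = 1`: e5m2 → binary8p3 / binary8p3f, e4m3 → binary8p4 /
  binary8p4f; `drMulEqPrec_named_iff`) — no named pair of equal precision has `d ≥ P + 1`, so on
  the matrix N-mul-E adds no cell to N-mul-U; what it adds is the DECISION: an embedded named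
  pair of equal precision double-rounds products correctly iff the quanta agree
  (`drMul_named_equal_precision_iff`, from THEOREM D-dm: the `13` diagonal cells and
  binary8p3 ⊆ binary8p3f, binary8p4 ⊆ binary8p4f hold, the `7` finer-quantum cells fail), the
  deep failing cell by N-mul-E and the `6` shallow ones (FP6 sources, `bias < m + 3`) by the
  register-tie laws N-mul-T (`drMul_named_equal_precision_failing`).  Beyond the matrix (records,
  not hardware): binary16 data in the record `Binary16X8` (binary16's precision behind an 8-bit
  exponent, `d = 112 > P`): sums and square roots double-round correctly, products and quotients
  do not (`binary16_exponent8_operations`); likewise a `P = 53` record behind a 15-bit exponent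
  (`Bin64`, `Bin64E15`, `d = 15360`; `bin64_exponent15_operations`).

Two implementations: A = `code/enum/mul_equal_precision_law.py` (exact rationals, two RNE
implementations: the N-mul-E family on pseudo-records `2 ≤ P ≤ 12`, every deep bias, every
`1 ≤ d ≤ 3P + 3`; brute force of D-mul-E on all pseudo-records `P ≤ 5`; the named cells) →
`certs/enum/DOUBLE-ROUNDING-MUL-EQPREC.json`; B = the kernel (this file).
PLACEMENT — KNOWN: harmful double rounding of products (and quotients, not sums) that underflow
in the destination but not in a register of equal precision and wider exponent range — "double
rounding on underflow" [ShudoMuraoka2000, §3.2] (their example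
`0x0008008000000000 × 0x3ff0000000000001`), [Monniaux2007, §3.1.2]; innocuous double rounding
needs `e_min` conditions once subnormals are present [Figueroa1995, §3], [Roux2014, §2 and
Table II].  NEW here (searched 2026-08-21, held corpus keyword + vector and galaxy, all corpora:
"double rounding underflow same precision", "store-reload", "double-rounding on underflow" — the
two sources above, an IEEE 754-2008 page and textbook rounding pages; no record-generic
statement): for every pair of records of equal precision ONE explicit product slips at EVERY
exponent distance `d ≥ 1` (uniformly: the largest significand times the successor of one, scaled
to the least subnormal), and for deep embedded sources the equal-precision register is innocuous
for products iff it adds no binade below.  No hardware or vendor claims.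
-/

namespace Summit.Ventures.CertifiedArithmetic

open Literature.ComputerArithmetic.FloatingPoint
open Literature.ComputerArithmetic.FloatingPoint.Format
open Literature.ComputerArithmetic.FloatingPoint.MiniFloat

/-! ## §1 THEOREM N-mul-E: at equal precision a finer quantum is never innocuous -/

/-- THEOREM N-mul-E — for EVERY pair of format records: `m_ψ = m_φ = m ≥ 1`, `d = L_φ - L_ψ ≥ 1`,
the data `a = (2^(m+1) - 1)·2^α` and `b = (2^m + 1)·2^β` quanta of `φ` in range with
`α + β + m + 3 = bias φ`, and `2^(d-1) ≤ M_ψ` `⟹ ¬ DRMul φ ψ`:  `a·b = q/2 + (2^m - 1)·q/2^(2m+2)`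
rounds in `ψ` to the midpoint `q/2` of `0` and `q = quantum φ` (for `d ≤ m + 1` by N-mul-U; for
`d ≥ m + 2` because `q/2 = 2^m·2^(d-1-m)` quanta of `ψ` is a value with a full significand and
the excess is below half the spacing `q/2^(m+1)` of `ψ` above it), then to `0` in `φ` (tie to
even), while `fl_φ (a·b) = q`.  No hypothesis relating the ranges beyond `2^(d-1) ≤ M_ψ`.
[this packet; cite: ShudoMuraoka2000, §3.2; cite: Monniaux2007, §3.1.2; cite: Figueroa1995, §3] -/
theorem not_drMul_of_equal_precision {φ ψ : Format} (hq : ψ.qexp + 1 ≤ φ.qexp)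
    (hm : ψ.manBits = φ.manBits) (h1 : 1 ≤ φ.manBits) {α β : ℕ}
    (hαβ : α + β + φ.manBits + 3 = φ.bias)
    (ha : (2 ^ (φ.manBits + 1) - 1) * 2 ^ α ≤ φ.maxScaled)
    (hb : (2 ^ φ.manBits + 1) * 2 ^ β ≤ φ.maxScaled)
    (hy : 2 ^ ((φ.qexp - ψ.qexp).toNat - 1) ≤ ψ.maxScaled) : ¬ DRMul φ ψ := by
  rcases Nat.lt_or_ge (φ.manBits + 1) (φ.qexp - ψ.qexp).toNat with hdm | hdm
  swap
  · exact not_drMul_of_underflow hq (by omega) h1 hαβ ha hb hy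
  intro hD
  have hq0 := φ.quantum_pos
  have hq1 := ψ.quantum_pos
  have hm2 : 2 ≤ 2 ^ φ.manBits := le_trans (by norm_num) (Nat.pow_le_pow_right (by norm_num) h1)
  set d := (φ.qexp - ψ.qexp).toNat with hd'
  have hQ : φ.quantum = 2 ^ d * ψ.quantum := quantum_eq_two_pow_mul (by omega)
  have hdX0 : (2 : ℚ) ^ d = 2 ^ (d - 1 - φ.manBits) * (2 * 2 ^ φ.manBits) := by
    rw [← pow_succ', ← pow_add]; congr 1; omega
  -- data
  obtain ⟨a, ha'⟩ := exists_toRat_eq_natMul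
    (representable_mul_pow (φ := φ) (k := 2 ^ (φ.manBits + 1) - 1) (j := α) (by omega) ha)
  obtain ⟨b, hb'⟩ := exists_toRat_eq_natMul
    (representable_mul_pow (φ := φ) (k := 2 ^ φ.manBits + 1) (j := β) (by omega) hb)
  have hA : (((2 ^ (φ.manBits + 1) - 1) * 2 ^ α : ℕ) : ℚ) = (2 * 2 ^ φ.manBits - 1) * 2 ^ α := by
    rw [Nat.cast_mul, Nat.cast_sub Nat.one_le_two_pow]; push_cast; ring
  have hB : (((2 ^ φ.manBits + 1) * 2 ^ β : ℕ) : ℚ) = (2 ^ φ.manBits + 1) * 2 ^ β := by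
    push_cast; ring
  -- the unit: `2^α · 2^β · 4 X² · q = 1` (`X = 2^m`)
  have hone : (2 : ℚ) ^ (φ.manBits + (φ.bias - 1)) * φ.quantum = 1 :=
    two_pow_mul_quantum_eq_one (by omega)
  have e1 : φ.manBits + (φ.bias - 1) = α + β + (φ.manBits + φ.manBits + 2) := by omega
  rw [e1, pow_add, pow_add, pow_add, pow_add] at hone
  have hX2 : (2 : ℚ) ≤ 2 ^ φ.manBits := by exact_mod_cast hm2
  -- the intermediate value `q/2 = 2^m · 2^(d-1-m)` quanta of `ψ`, a full-significand value
  have hμ : φ.quantum / 2 = ((2 ^ ψ.manBits * 2 ^ (d - 1 - φ.manBits) : ℕ) : ℚ) * ψ.quantum := by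
    push_cast
    rw [hm, hQ, hdX0]; ring
  have key := hD a b
  rw [ha', hb', hA, hB] at key
  generalize hX : (2 : ℚ) ^ φ.manBits = X at hone hX2 key hdX0
  have hXpos : 0 < X := by linarith
  have hunit : (2 : ℚ) ^ α * 2 ^ β * φ.quantum = 1 / (4 * X ^ 2) := by
    rw [eq_div_iff (by positivity), ← hone]; ring
  -- the product `a·b = q/2 + ε`, `ε = (X - 1)·q/(4X²)`
  set ε : ℚ := (X - 1) * φ.quantum / (4 * X ^ 2) with hε
  have hprod : (2 * X - 1) * 2 ^ α * φ.quantum * ((X + 1) * 2 ^ β * φ.quantum)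
      = φ.quantum / 2 + ε := by
    calc (2 * X - 1) * 2 ^ α * φ.quantum * ((X + 1) * 2 ^ β * φ.quantum)
        = (2 * X - 1) * (X + 1) * ((2 : ℚ) ^ α * 2 ^ β * φ.quantum) * φ.quantum := by ring
      _ = (2 * X - 1) * (X + 1) * (1 / (4 * X ^ 2)) * φ.quantum := by rw [hunit]
      _ = φ.quantum / 2 + ε := by rw [hε]; field_simp; ring
  have hεpos : 0 < ε := by
    rw [hε]; exact div_pos (mul_pos (by linarith) hq0) (by positivity)
  -- `ε < q/(4X)`: below half the spacing `q/(2X)` of `ψ` above `q/2`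
  have hε4 : ε < φ.quantum / (4 * X) := by
    rw [hε, div_lt_div_iff₀ (by positivity) (by positivity)]
    nlinarith [mul_pos hq0 hXpos]
  have hεq : ε < φ.quantum / 2 := by
    refine lt_of_lt_of_le hε4 ?_
    rw [div_le_div_iff₀ (by positivity) (by norm_num)]
    nlinarith
  have hsp : (2 : ℚ) ^ (d - 1 - φ.manBits) * ψ.quantum = φ.quantum / (2 * X) := by
    rw [hQ, hdX0]; field_simp
  have hY : (roundNE ψ (φ.quantum / 2 + ε)).toRat = φ.quantum / 2 := by
    rw [hμ]
    refine toRat_roundNE_full_add_small le_rfl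
      (Nat.pow_lt_pow_right (by norm_num) (by omega)) ?_ hεpos.le ?_
    · rw [← pow_add, show ψ.manBits + (d - 1 - φ.manBits) = d - 1 by omega]; exact hy
    · rw [hsp, lt_div_iff₀ (by positivity)]
      rw [lt_div_iff₀ (by positivity)] at hε4
      linarith
  -- the two roundings in `φ`
  have hM1 : 1 ≤ φ.maxScaled := by
    have : 0 < (2 ^ φ.manBits + 1) * 2 ^ β := by positivity
    omega
  have hX1 : (roundNE φ (φ.quantum / 2)).toRat = 0 := by
    have h := toRat_roundNE_half_of_even h1 (j := 0) ⟨0, rfl⟩ (by omega) (by omega)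
    have e : φ.quantum / 2 = ((2 * 0 + 1 : ℕ) : ℚ) / 2 * φ.quantum := by push_cast; ring
    rw [e, h]; push_cast; ring
  have hX2r : (roundNE φ (φ.quantum / 2 + ε)).toRat = φ.quantum := by
    have hrep : φ.Representable 1 := representable_of_lt_pow (by omega) hM1
    have e : φ.quantum / 2 + ε = ((1 : ℕ) : ℚ) * φ.quantum + (ε - φ.quantum / 2) := by
      push_cast; ring
    rw [e, toRat_roundNE_natMul_add_small hrep
      (by rw [abs_of_neg (by linarith), neg_sub]; linarith)]
    push_cast; ring
  rw [hprod, hY, hX1, hX2r] at key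
  linarith

/-! ## §2 The converse at equal quanta -/

/-- SAME QUANTUM, SAME PRECISION, NESTED TOPS: every dyadic rational `K·q/2^u` (`q` the common
quantum, `u ≥ 1`) double-rounds correctly through `ψ` when `m_ψ = m_φ = m ≥ 1`, `L_ψ = L_φ` and
`M_φ ≤ M_ψ`: with `K = c·2^u + r`, either `c + 1 < 2^(m+1)` (the fine zone: both formats hold
`c q` and `(c+1) q`, `sameQ_roundNE_roundNE_low`, or `x ≥ maxRat φ` saturates), or
`x ≥ c q ≥ 2^m q` and the band corollary applies (saturation included). [this packet] -/
theorem sameQ_eqPrec_roundNE_roundNE {φ ψ : Format} (hq : ψ.qexp = φ.qexp)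
    (hm : ψ.manBits = φ.manBits) (h1 : 1 ≤ φ.manBits) (hM : φ.maxScaled ≤ ψ.maxScaled)
    (K : ℕ) {u : ℕ} (hu : 1 ≤ u) :
    (roundNE φ (roundNE ψ (((K : ℕ) : ℚ) * φ.quantum / 2 ^ u)).toRat).toRat
      = (roundNE φ (((K : ℕ) : ℚ) * φ.quantum / 2 ^ u)).toRat := by
  have hq0 := φ.quantum_pos
  have hmax : φ.maxRat ≤ ψ.maxRat := (maxRat_le_maxRat_iff hq.le).2
    (by rwa [show (φ.qexp - ψ.qexp).toNat = 0 by omega, pow_zero, mul_one])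
  obtain ⟨c, hc'⟩ : ∃ c, K / 2 ^ u = c := ⟨_, rfl⟩
  obtain ⟨r, hr'⟩ : ∃ r, K % 2 ^ u = r := ⟨_, rfl⟩
  obtain ⟨hKcr, hrK⟩ := (Nat.div_mod_unique (a := K) (b := 2 ^ u) (c := r) (d := c)
    (by positivity)).mp ⟨hc', hr'⟩
  have hKcr' : K = c * 2 ^ u + r := by rw [← hKcr]; ring
  subst hKcr'
  have hxs : (((c * 2 ^ u + r : ℕ) : ℚ) * φ.quantum / 2 ^ u)
      = (c : ℚ) * φ.quantum + (r : ℚ) * (φ.quantum / 2 ^ u) := by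
    push_cast; field_simp
  have hx0 : 0 ≤ ((c * 2 ^ u + r : ℕ) : ℚ) * φ.quantum / 2 ^ u := by positivity
  have hcx : (c : ℚ) * φ.quantum ≤ ((c * 2 ^ u + r : ℕ) : ℚ) * φ.quantum / 2 ^ u := by
    rw [hxs]
    have : 0 ≤ (r : ℚ) * (φ.quantum / 2 ^ u) := by positivity
    linarith
  rcases Nat.lt_or_ge (c + 1) (2 ^ (φ.manBits + 1)) with hlow | hhigh
  · -- the fine zone (or saturation)
    rcases le_or_gt φ.maxRat (((c * 2 ^ u + r : ℕ) : ℚ) * φ.quantum / 2 ^ u) with hsat | hlt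
    · obtain ⟨z, hz⟩ := exists_toRat_eq_of_le (le_of_eq hm.symm) hq.le hmax (MiniFloat.top φ)
      exact toRat_roundNE_roundNE_of_maxRat_le_abs ⟨z, hz.trans toRat_top⟩
        (by rwa [abs_of_nonneg hx0])
    · have hcM : c + 1 ≤ φ.maxScaled := by
        have h' : (c : ℚ) * φ.quantum < (φ.maxScaled : ℚ) * φ.quantum := lt_of_le_of_lt hcx hlt
        exact Nat.succ_le_of_lt (by exact_mod_cast lt_of_mul_lt_mul_right h' hq0.le)
      exact sameQ_roundNE_roundNE_low hq h1 (by omega) hu hrK hlow.le hcM (by rw [hm]; exact hlow)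
        (le_trans hcM hM)
  · -- from `2^m q` on: the band corollary
    have hlo : 2 ^ φ.manBits * φ.quantum ≤ |((c * 2 ^ u + r : ℕ) : ℚ) * φ.quantum / 2 ^ u| := by
      rw [abs_of_nonneg hx0]
      refine le_trans ?_ hcx
      have h2 : 2 ^ φ.manBits ≤ c := by rw [pow_succ] at hhigh; omega
      exact mul_le_mul_of_nonneg_right (by exact_mod_cast h2) hq0.le
    exact toRat_roundNE_roundNE_of_manBits_eq_of_le hm.symm h1 hq.le hmax hlo

/-- THE CONVERSE AT `d = 0` — for EVERY pair of records: `L_ψ = L_φ`, `m_ψ = m_φ = m ≥ 1`,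
`M_φ ≤ M_ψ` `⟹ DRMul φ ψ` (a product `a·b` is `±K·q/2^u` with `u = 1 - L_φ ≥ 1`); no hypothesis
on the ranges beyond the nesting of the tops. [this packet; cite: Figueroa1995, §2] -/
theorem drMul_of_equal_precision_sameQ {φ ψ : Format} (hq : ψ.qexp = φ.qexp)
    (hm : ψ.manBits = φ.manBits) (h1 : 1 ≤ φ.manBits) (hM : φ.maxScaled ≤ ψ.maxScaled) :
    DRMul φ ψ := by
  intro a b
  apply toRat_roundNE_roundNE_of_abs
  obtain ⟨u, hu'⟩ : ∃ u : ℕ, (-φ.qexp).toNat = u := ⟨_, rfl⟩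
  have hql : φ.qexp ≤ 0 := by unfold Format.qexp; omega
  have hqu : φ.qexp = -(u : ℤ) := by omega
  have hpw : (2 : ℚ) ^ φ.qexp = 1 / 2 ^ u := by rw [hqu, zpow_neg, zpow_natCast, one_div]
  have hx : |a.toRat * b.toRat|
      = ((a.scaledMag * b.scaledMag * 2 : ℕ) : ℚ) * φ.quantum / 2 ^ (u + 1) := by
    rw [abs_toRat_mul_toRat, zpow_add₀ two_ne_zero]
    unfold Format.quantum
    rw [hpw, pow_succ]; push_cast; field_simp
  rw [hx]
  exact sameQ_eqPrec_roundNE_roundNE hq hm h1 hM _ (by omega)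

/-! ## §3 DECISION D-mul-E and the hypothesis of N-mul-E as a boolean test -/

/-- DECISION D-mul-E — for EVERY pair of records: `F_φ ⊆ F_ψ` (`embedsTest`), `m_ψ = m_φ = m ≥ 1`,
a deep source `m + 3 ≤ bias φ` with `2^(m+1) - 1` and `(2^m + 1)·2^(bias-m-3)` quanta in range:
`DRMul φ ψ ↔ L_ψ = L_φ` (`→`: N-mul-E at `α = 0`, `β = bias - m - 3`, with
`2^(d-1) ≤ M_φ·2^d ≤ M_ψ`; `←`: §2). [this packet] -/
theorem drMul_equal_precision_iff {φ ψ : Format} (hE : embedsTest φ ψ = true)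
    (hm : ψ.manBits = φ.manBits) (h1 : 1 ≤ φ.manBits) (hdeep : φ.manBits + 3 ≤ φ.bias)
    (ha : 2 ^ (φ.manBits + 1) - 1 ≤ φ.maxScaled)
    (hb : (2 ^ φ.manBits + 1) * 2 ^ (φ.bias - φ.manBits - 3) ≤ φ.maxScaled) :
    DRMul φ ψ ↔ ψ.qexp = φ.qexp := by
  simp only [embedsTest, Bool.and_eq_true, decide_eq_true_eq] at hE
  obtain ⟨⟨-, hq⟩, hMM⟩ := hE
  have hM0 : 0 < φ.maxScaled := by
    have h2 : 2 ≤ 2 ^ (φ.manBits + 1) := by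
      have := Nat.one_le_two_pow (n := φ.manBits); rw [pow_succ]; omega
    omega
  constructor
  · intro hD
    by_contra hne
    refine not_drMul_of_equal_precision (by omega) hm h1 (α := 0) (β := φ.bias - φ.manBits - 3)
      (by omega) (by simpa using ha) hb ?_ hD
    calc 2 ^ ((φ.qexp - ψ.qexp).toNat - 1) ≤ 2 ^ (φ.qexp - ψ.qexp).toNat :=
          Nat.pow_le_pow_right (by norm_num) (by omega)
      _ ≤ φ.maxScaled * 2 ^ (φ.qexp - ψ.qexp).toNat :=
          Nat.le_mul_of_pos_left _ hM0
      _ ≤ ψ.maxScaled := hMM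
  · intro hq0
    rw [show (φ.qexp - ψ.qexp).toNat = 0 by omega, pow_zero, mul_one] at hMM
    exact drMul_of_equal_precision_sameQ hq0 hm h1 hMM

/-- THE HYPOTHESIS OF N-mul-E AS A BOOLEAN TEST on parameter records, at the canonical exponents
`α = 0`, `β = bias_X - m_X - 3` (as `drMulUnderflowTest`, without its bound `d ≤ m + 1`).
[this packet] -/
def drMulEqPrecTest (X Y : Format) : Bool :=
  let d := (X.qexp - Y.qexp).toNat
  let β := X.bias - X.manBits - 3
  decide (Y.qexp + 1 ≤ X.qexp) && decide (Y.manBits = X.manBits) &&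
  decide (1 ≤ X.manBits) && decide (X.manBits + 3 ≤ X.bias) &&
  decide ((2 ^ (X.manBits + 1) - 1) * 2 ^ 0 ≤ X.maxScaled) &&
  decide ((2 ^ X.manBits + 1) * 2 ^ β ≤ X.maxScaled) && decide (2 ^ (d - 1) ≤ Y.maxScaled)

/-- SOUNDNESS OF THE TEST: `drMulEqPrecTest X Y ⟹ ¬ DRMul X Y`. [this packet] -/
theorem not_drMul_of_eqPrecTest {X Y : Format} (h : drMulEqPrecTest X Y = true) :
    ¬ DRMul X Y := by
  simp only [drMulEqPrecTest, Bool.and_eq_true, decide_eq_true_eq] at h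
  obtain ⟨⟨⟨⟨⟨⟨hq, hm⟩, h1⟩, hβ⟩, ha⟩, hb⟩, hy⟩ := h
  exact not_drMul_of_equal_precision hq hm h1 (α := 0) (β := X.bias - X.manBits - 3)
    (by omega) ha hb hy

/-- THE HYPOTHESES OF D-mul-E AS A BOOLEAN TEST. [this packet] -/
def drMulEqPrecHyp (X Y : Format) : Bool :=
  embedsTest X Y && decide (Y.manBits = X.manBits) && decide (1 ≤ X.manBits) &&
  decide (X.manBits + 3 ≤ X.bias) && decide (2 ^ (X.manBits + 1) - 1 ≤ X.maxScaled) &&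
  decide ((2 ^ X.manBits + 1) * 2 ^ (X.bias - X.manBits - 3) ≤ X.maxScaled)

/-- D-mul-E read through its test: `drMulEqPrecHyp X Y ⟹ (DRMul X Y ↔ L_Y = L_X)`.
[this packet] -/
theorem drMul_iff_of_eqPrecHyp {X Y : Format} (h : drMulEqPrecHyp X Y = true) :
    DRMul X Y ↔ Y.qexp = X.qexp := by
  simp only [drMulEqPrecHyp, Bool.and_eq_true, decide_eq_true_eq] at h
  obtain ⟨⟨⟨⟨⟨hE, hm⟩, h1⟩, hβ⟩, ha⟩, hb⟩ := h
  exact drMul_equal_precision_iff hE hm h1 hβ ha hb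

/-! ## §4 The named records, and two equal-precision registers beyond the matrix -/

/-- ON THE NAMED `13 × 13` MATRIX the test holds on exactly the `4` cells of `drMulUnderflowTest`
(`drMulUnderflow_named_iff`), all with `d = 1`: no named pair of equal precision has
`d ≥ P + 1`. [this packet] -/
theorem drMulEqPrec_named_iff : ∀ X ∈ namedFormats, ∀ Y ∈ namedFormats,
    drMulEqPrecTest X Y = true ↔
    (X, Y) ∈ [(E4M3, Binary8p4), (E4M3, Binary8p4F), (E5M2, Binary8p3), (E5M2, Binary8p3F)] := by
  decide +kernel

/-- DECISION D-mul-E ON THE NAMED MATRIX: an embedded named pair of EQUAL precision double-rounds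
products correctly iff the quanta agree (hold: the `13` diagonal cells, binary8p3 ⊆ binary8p3f,
binary8p4 ⊆ binary8p4f; fail: e3m2 → e5m2 / binary8p3 / binary8p3f, e2m3 → e4m3 / binary8p4 /
binary8p4f, e5m2 → binary8p3f) — read off THEOREM D-dm (`drMul_named_iff`). [this packet] -/
theorem drMul_named_equal_precision_iff : ∀ X ∈ namedFormats, ∀ Y ∈ namedFormats,
    embedsTest X Y = true → X.manBits = Y.manBits → (DRMul X Y ↔ X.qexp = Y.qexp) := by
  intro X hX Y hY he hm
  rw [drMul_named_iff hX hY]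
  revert X Y
  decide +kernel

/-- THE `7` FAILING EQUAL-PRECISION EMBEDDED CELLS BY LAW: the deep source (e5m2 → binary8p3f)
satisfies `drMulEqPrecTest`, the shallow ones (`bias < m + 3`: the FP6 sources) a register-tie
test of THEOREM N-mul-T (`DoubleRoundingProductTie.lean`), and never both. [this packet] -/
theorem drMul_named_equal_precision_failing : ∀ X ∈ namedFormats, ∀ Y ∈ namedFormats,
    embedsTest X Y = true → X.manBits = Y.manBits → X.qexp ≠ Y.qexp →
    (drMulEqPrecTest X Y = true ↔ X.manBits + 3 ≤ X.bias) ∧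
    ((drMulTie9Test X Y || drMulTie21Test X Y) = true ↔ X.bias < X.manBits + 3) := by
  decide +kernel

/-- binary16 DATA IN THE RECORD `Binary16X8` (binary16's precision `P = 11` behind an 8-bit
exponent, `DoubleRoundingSqrtEqualPrecision.lean`; `d = 136 - 24 = 112 > P`, outside N-mul-U):
sums and square roots double-round correctly (`drAdd_of_manBits_eq`,
`drSqrt_Binary16_exponent8`), products (N-mul-E: `2047·2^-24 · 1025·2^-22 ↦ 2^-25 ↦ 0`,
directly `2^-24`) and quotients (N-div-E) do not.  A statement about two parameter records.
[this packet; cite: Monniaux2007, §3.1.2] -/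
theorem binary16_exponent8_operations :
    DRAdd Binary16 Binary16X8 ∧ DRSqrt Binary16 Binary16X8 ∧
    ¬ DRMul Binary16 Binary16X8 ∧ ¬ DRDiv Binary16 Binary16X8 ∧
    drMulUnderflowTest Binary16 Binary16X8 = false :=
  ⟨drAdd_of_manBits_eq rfl (by decide) (by decide)
      ((maxRat_le_maxRat_iff (by decide)).2 (by decide +kernel)),
    drSqrt_Binary16_exponent8.1, not_drMul_of_eqPrecTest (by decide +kernel),
    not_drDiv_of_eqNegTest (by decide +kernel), by decide +kernel⟩

/-- The record with a `53`-bit significand (`m = 52`) behind an 11-bit exponent (`bias 1023`,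
codes `0 … 2046`): the parameters of binary64 [IEEE7542019, §3.6, Table 3.5]. -/
def Bin64 : Format := ⟨52, 1023, 2046, 2 ^ 52 - 1, by decide⟩

/-- The record with the same `53`-bit significand behind a 15-bit exponent (`bias 16383`, codes
`0 … 32766`; `L = -16434`, `d = 15360`): the format in which a product of binary64 data lands
when only its significand is rounded to `53` bits inside the wider exponent range
([ShudoMuraoka2000, §2 and Fig. 2]; [Monniaux2007, §3.1.2]).  A parameter record; no hardware
claims. -/
def Bin64E15 : Format := ⟨52, 16383, 32766, 2 ^ 52 - 1, by decide⟩

/-- "DOUBLE ROUNDING ON UNDERFLOW" AS AN INSTANCE OF THE RECORD-GENERIC LAWS: `Bin64` data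
through `Bin64E15` — sums correct (`drAdd_of_manBits_eq`), products not (N-mul-E at `d = 15360`:
`(2^53 - 1)·2^-1074 · (2^52 + 1)·2^-106 ↦ 2^-1075 ↦ 0`, directly `2^-1074`; N-mul-U does not
reach this `d`), quotients not (N-div-E). [this packet; cite: ShudoMuraoka2000, §3.2] -/
theorem bin64_exponent15_operations :
    DRAdd Bin64 Bin64E15 ∧ ¬ DRMul Bin64 Bin64E15 ∧ ¬ DRDiv Bin64 Bin64E15 ∧
    drMulUnderflowTest Bin64 Bin64E15 = false :=
  ⟨drAdd_of_manBits_eq rfl (by decide) (by decide)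
      ((maxRat_le_maxRat_iff (by decide)).2 (by decide +kernel)),
    not_drMul_of_eqPrecTest (by decide +kernel), not_drDiv_of_eqNegTest (by decide +kernel),
    by decide +kernel⟩

end Summit.Ventures.CertifiedArithmetic
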